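import Summits.NavierStokesRegularity.FluidComputer.PalasekTowerGermHostPushed

/-!
# The germ host, XIV: the pushed line anchor under the TOLERANT first-order test `⟪U, V⟫ > −κY²/4`

Cell `ns-blowup`, seat `ns-blowup-ecbridge-3` (g3); GROUP C «BRIDGE SUPPORT» of the route
`PalasekTowerBreakdown` (crux `EpisodeBaseG`, item stmt-NavierStokesRegularity-19179, R2 of record).
Companion of ecbridge-4's `PalasekTowerGermPushedAnchor.lean` (p445609: `exists_pushed_line_anchor` under
the WEAK test `⟪U, V⟫ ≥ 0`) whose proof is reused here VERBATIM up to one line; consumed by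
`PalasekTowerGermHostTolerant.lean` (the tolerant slot `LevelZeroDataTol c₄`). LABEL: E–C typing (KERNEL
calculus: one compactness lemma; everything proved, no definitions). WHAT THIS IS NOT: not Navier–Stokes
evidence — no flow, stage or schedule is built here.

## The point: THE PUSH PAYS FOR VISCOUS DECAY AT THE SPEED MAXIMUM

The pushed germ `u(t) = (1 − κ(1 − t)) • (U + σ(t) • V)` (`σ(t) ∈ [−(1 − t), 0]`, `V = P(νΔU − (U·∇)U)`)
arrives at `U` with `∂ₜu(τ₀) = κU + V` and residual `κU` (admissible for `κ ≤ c₄/2`). Its global anchor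
`‖u(t)‖ < Y` for `t < τ₀` does NOT need `⟪U, V⟫ ≥ 0` on the argmax (ecbridge-4's weak test): near the
argmax `‖u‖² ≤ (1 − κs)(Y² + 2|σ|·(−⟪U,V⟫)₊ + s²M²)` and the factor loses `κsY²` while the segment
gains at most `2s · κY²/4 = κsY²/2` as long as **`⟪U, V⟫ > −κY²/4`** there — ecbridge-4's proof already
runs on the open set `{⟪U, V⟫ > −κY²/4}` and uses the weak test only to place the argmax inside it. So:

* **`exists_pushed_line_anchor_tol`**: `U ∈ C_c^∞`, `‖U‖ ≤ Y`, `κ > 0`, and `⟪U(x), V(x)⟫ > −κY²/4`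
  wherever `‖U(x)‖ = Y` ⇒ `∃ s₀ ∈ (0, 1/2]`, `κs₀ ≤ 1`, with `(1 − κs)‖U(x) + σV(x)‖ < Y` for all
  `s ∈ (0, s₀]`, `σ ∈ [−s, 0]`, `x` — exactly the `hanch` input of ecbridge-4's `norm_germ_pushed_lt/le`.

Reading (HEUR label): for a snapshot `U = u(t⋆)` of a free flow, `⟪U, V⟫(x₀) = ½ ∂ₜ‖u‖²(t⋆, x₀)`; the
tolerant test admits profiles whose speed maximum is DECAYING, at relative rate `< κ/4` per unit time
(`κ = c₄/2` in the host of XV): viscous-dominated blobs of size `ℓ ≳ (8C/c₄)^{1/2}` at `ν = 1` pass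
without any pressure push. [cite: MajdaBertozziCUP2002, §1.8 Prop. 1.16]
-/

noncomputable section

namespace Summit.NavierStokesRegularity.FluidComputer.PalasekTowerClayBridge.Germ

open Set Function Filter Topology InnerProductSpace Metric MeasureTheory
open scoped Topology ContDiff RealInnerProductSpace ENNReal

open Literature.Analysis.FluidPDE

variable {ν : ℝ} {U : EuclideanSpace ℝ (Fin 3) → EuclideanSpace ℝ (Fin 3)}

/-- **THE PUSHED LINE ANCHOR FROM THE TOLERANT TEST.** Let `U` be smooth with compact support, `‖U‖ ≤ Y`
everywhere (`Y > 0`), `κ > 0`, and suppose `⟪U(x), V(x)⟫ > −κY²/4` wherever `‖U(x)‖ = Y`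
(`V = P(νΔU − (U·∇)U)`). Then there is `s₀ ∈ (0, 1/2]` with `κ s₀ ≤ 1` such that for every `s ∈ (0, s₀]`,
every `σ ∈ [−s, 0]` and every `x`: `(1 − κ s) ‖U(x) + σ V(x)‖ < Y`. Proof = ecbridge-4's
`exists_pushed_line_anchor` verbatim (the weak test was used only to show `‖U‖ < Y` on the compact
`{⟪U,V⟫ ≤ −κY²/4} ∩ tsupport U`, which the tolerant test gives directly). [cite: MajdaBertozziCUP2002, §1.8 Prop. 1.16] -/
theorem exists_pushed_line_anchor_tol (hU : ContDiff ℝ ∞ U) (hUc : HasCompactSupport U) {Y κ : ℝ}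
    (hY : 0 < Y) (hκ : 0 < κ) (hle : ∀ x, ‖U x‖ ≤ Y)
    (htest : ∀ x, ‖U x‖ = Y → -(κ * Y ^ 2 / 4) < ⟪U x, accel ν U x⟫) :
    ∃ s₀ : ℝ, 0 < s₀ ∧ s₀ ≤ 1 / 2 ∧ κ * s₀ ≤ 1 ∧
      ∀ s : ℝ, 0 < s → s ≤ s₀ → ∀ σ : ℝ, -s ≤ σ → σ ≤ 0 →
        ∀ x, (1 - κ * s) * ‖U x + σ • accel ν U x‖ < Y := by
  set V := accel ν U with hV
  set g : EuclideanSpace ℝ (Fin 3) → ℝ := fun x => ⟪U x, V x⟫ with hg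
  have hUcont : Continuous U := hU.continuous
  have hVcont : Continuous V := (contDiff_accel hU hUc ν).continuous
  have hgc : Continuous g := hUcont.inner hVcont
  have hnc : Continuous fun x => ‖U x‖ := hUcont.norm
  obtain ⟨M, hM0, hM⟩ := exists_norm_accel_le hU hUc ν
  -- the compact support, and its part where the test function is `≤ −κY²/4`
  set K := tsupport U with hK
  have hKc : IsCompact K := hUc
  set K₁ := K ∩ {x | g x ≤ -(κ * Y ^ 2 / 4)} with hK₁
  have hK₁c : IsCompact K₁ := hKc.inter_right (isClosed_le hgc continuous_const)
  have hlt₁ : ∀ x ∈ K₁, -Y < -‖U x‖ := by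
    intro x hx
    have hne : ‖U x‖ ≠ Y := by
      intro h
      have h1 := htest x h
      have h2 : g x ≤ -(κ * Y ^ 2 / 4) := hx.2
      simp only [hg] at h2
      linarith
    have := lt_of_le_of_ne (hle x) hne
    linarith
  obtain ⟨a₁, ha₁, ha₁'⟩ := hK₁c.exists_forall_le' (f := fun x => -‖U x‖) hnc.neg.continuousOn hlt₁
  set δ := min (Y + a₁) Y with hδ
  have hδ0 : 0 < δ := lt_min (by linarith) hY
  have hδY : δ ≤ Y := min_le_right _ _
  have hK₁U : ∀ x ∈ K₁, ‖U x‖ ≤ Y - δ := by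
    intro x hx
    have := ha₁' x hx
    have : δ ≤ Y + a₁ := min_le_left _ _
    linarith
  -- off `K₁`: either off the support (`U = 0`) or the test function is `> −κY²/4`
  have hsplit : ∀ x, x ∉ K₁ → ‖U x‖ ≤ Y - δ ∨ -(κ * Y ^ 2 / 4) < g x := by
    intro x hx
    by_cases hxK : x ∈ K
    · right
      by_contra h
      exact hx ⟨hxK, not_lt.1 h⟩
    · left
      have : U x = 0 := image_eq_zero_of_notMem_tsupport hxK
      rw [this, norm_zero]
      linarith
  -- the width
  set s₀ := min (1 / 2) (min (1 / (2 * κ)) (min (κ * Y ^ 2 / (4 * (M ^ 2 + 1))) (δ / (2 * (M + 1)))))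
    with hs₀
  have hs₀0 : 0 < s₀ := lt_min (by norm_num) (lt_min (by positivity) (lt_min (by positivity) (by positivity)))
  have hs₀half : s₀ ≤ 1 / 2 := min_le_left _ _
  have hs₀κ : s₀ ≤ 1 / (2 * κ) := (min_le_right _ _).trans (min_le_left _ _)
  have hs₀near : s₀ ≤ κ * Y ^ 2 / (4 * (M ^ 2 + 1)) :=
    (min_le_right _ _).trans ((min_le_right _ _).trans (min_le_left _ _))
  have hs₀far : s₀ ≤ δ / (2 * (M + 1)) :=
    (min_le_right _ _).trans ((min_le_right _ _).trans (min_le_right _ _))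
  have hκs₀ : κ * s₀ ≤ 1 := by
    have h1 : κ * s₀ ≤ κ * (1 / (2 * κ)) := mul_le_mul_of_nonneg_left hs₀κ hκ.le
    have h2 : κ * (1 / (2 * κ)) = 1 / 2 := by field_simp
    linarith
  refine ⟨s₀, hs₀0, hs₀half, hκs₀, fun s hs0 hss σ hσl hσu x => ?_⟩
  have hκs : κ * s ≤ 1 := (mul_le_mul_of_nonneg_left hss hκ.le).trans hκs₀
  have hfac0 : 0 ≤ 1 - κ * s := by linarith
  have hfac1 : 1 - κ * s ≤ 1 := by nlinarith
  have hVx : ‖V x‖ ≤ M := hM x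
  have hσabs : |σ| ≤ s := by rw [abs_le]; exact ⟨hσl, by linarith⟩
  -- the far estimate, used in two cases
  have hfar : ‖U x‖ ≤ Y - δ → (1 - κ * s) * ‖U x + σ • V x‖ < Y := by
    intro hUx
    have hsM : s * (2 * (M + 1)) ≤ δ := by
      have := hss.trans hs₀far
      rwa [le_div_iff₀ (by positivity)] at this
    calc (1 - κ * s) * ‖U x + σ • V x‖ ≤ 1 * ‖U x + σ • V x‖ :=
          mul_le_mul_of_nonneg_right hfac1 (norm_nonneg _)
      _ ≤ ‖U x‖ + ‖σ • V x‖ := by rw [one_mul]; exact norm_add_le _ _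
      _ = ‖U x‖ + |σ| * ‖V x‖ := by rw [norm_smul, Real.norm_eq_abs]
      _ ≤ (Y - δ) + s * M := add_le_add hUx (mul_le_mul hσabs hVx (norm_nonneg _) hs0.le)
      _ < Y := by nlinarith
  by_cases hx1 : x ∈ K₁
  · exact hfar (hK₁U x hx1)
  rcases hsplit x hx1 with hUx | hgx
  · exact hfar hUx
  -- near the maximum: the factor wins
  have hsq : ‖U x + σ • V x‖ ^ 2 ≤ Y ^ 2 + κ * s * Y ^ 2 / 2 + s ^ 2 * M ^ 2 := by
    rw [norm_add_smul_sq]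
    have h1 : ‖U x‖ ^ 2 ≤ Y ^ 2 := pow_le_pow_left₀ (norm_nonneg _) (hle x) 2
    have h2 : 2 * σ * ⟪U x, V x⟫ ≤ κ * s * Y ^ 2 / 2 := by
      -- `σ ∈ [−s, 0]` and `⟪U,V⟫ > −κY²/4`
      have hg' : -(κ * Y ^ 2 / 4) < ⟪U x, V x⟫ := hgx
      have hσ' : 0 ≤ -σ := by linarith
      have hσs : -σ ≤ s := by linarith
      have hpos : 0 ≤ κ * s * Y ^ 2 / 2 := by positivity
      rcases le_or_gt 0 ⟪U x, V x⟫ with hg0 | hg0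
      · have : 0 ≤ -σ * ⟪U x, V x⟫ := mul_nonneg hσ' hg0
        linarith
      · have hng : 0 ≤ -⟪U x, V x⟫ := by linarith
        have hng' : -⟪U x, V x⟫ ≤ κ * Y ^ 2 / 4 := by linarith
        have := mul_le_mul hσs hng' hng hs0.le
        nlinarith
    have h3 : σ ^ 2 * ‖V x‖ ^ 2 ≤ s ^ 2 * M ^ 2 := by
      have hσ2 : σ ^ 2 ≤ s ^ 2 := by
        rw [← sq_abs σ]; exact pow_le_pow_left₀ (abs_nonneg _) hσabs 2
      exact mul_le_mul hσ2 (pow_le_pow_left₀ (norm_nonneg _) hVx 2) (sq_nonneg _) (sq_nonneg _)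
    linarith
  have hsM2 : s * (4 * (M ^ 2 + 1)) ≤ κ * Y ^ 2 := by
    have := hss.trans hs₀near
    rwa [le_div_iff₀ (by positivity)] at this
  have hsq' : ((1 - κ * s) * ‖U x + σ • V x‖) ^ 2 < Y ^ 2 := by
    rw [mul_pow]
    have hf2 : (1 - κ * s) ^ 2 ≤ 1 - κ * s := by nlinarith
    have hsM : s * M ^ 2 < κ * Y ^ 2 / 2 := by nlinarith [sq_nonneg M]
    have key : s ^ 2 * M ^ 2 < κ * s * Y ^ 2 / 2 := by nlinarith
    have hA : 0 ≤ κ ^ 2 * s ^ 2 * Y ^ 2 / 2 := by positivity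
    have hB : 0 ≤ κ * s ^ 3 * M ^ 2 := by positivity
    have expand : (1 - κ * s) * (Y ^ 2 + κ * s * Y ^ 2 / 2 + s ^ 2 * M ^ 2) =
        Y ^ 2 - κ * s * Y ^ 2 / 2 + s ^ 2 * M ^ 2 - κ ^ 2 * s ^ 2 * Y ^ 2 / 2 - κ * s ^ 3 * M ^ 2 := by
      ring
    calc (1 - κ * s) ^ 2 * ‖U x + σ • V x‖ ^ 2
        ≤ (1 - κ * s) * (Y ^ 2 + κ * s * Y ^ 2 / 2 + s ^ 2 * M ^ 2) :=
          mul_le_mul hf2 hsq (sq_nonneg _) hfac0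
      _ < Y ^ 2 := by rw [expand]; linarith
  exact lt_of_pow_lt_pow_left₀ 2 hY.le hsq'

/-- The weak test implies the tolerant one. [folklore] -/
theorem tolerant_of_weak {Y κ : ℝ} (hY : 0 < Y) (hκ : 0 < κ)
    (htest : ∀ x, ‖U x‖ = Y → 0 ≤ ⟪U x, accel ν U x⟫) :
    ∀ x, ‖U x‖ = Y → -(κ * Y ^ 2 / 4) < ⟪U x, accel ν U x⟫ := fun x hx => by
  have h := htest x hx
  have : 0 < κ * Y ^ 2 / 4 := by positivity
  linarith

end Summit.NavierStokesRegularity.FluidComputer.PalasekTowerClayBridge.Germ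

end
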